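import Summits.QuantumFields.YangMills.Theorems.FluctuationComparisonRegPrIntLS2BetaResidualCommutatorLetter
import Literature.MathematicalPhysics.QuantumFieldTheory.Balaban1983to89.B10StarCount
import HarnessLib

/-!
# S2β · GAP♯∘ — (RES-u.4′) «THE GRADIENT FEED»: ✓p839678's image-pair gradient hypothesis `hτ′` FROM a gradient letter over COARSE BONDS
# (the image pair of a fine bond under `blockUp k` is a point or a coarse bond), and the size of the moved background's commutator factor
# `E′ = U₀·(ǔ⁻¹•U₀)⁻¹` with EVERY input named: `dist1 (E′ b) ≤ 4σ + (4σ_V + e)`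

Cell `ym3-torus` (rung R3 = continuum `SU(2)` YM₃ on T³ at fixed lattice data — NOT d = 4, NOT infinite volume, NOT a mass gap, NOT Clay).  Width seat
`ym-ust-20520-w5` (gen 29), explicit-unit helper on crux `stmt-QuantumFields-20520` `FluctuationComparisonRegPrIntL`, LINE g18-1 S2β (registry
`Lines/semiclassical_s2beta.lean` untouched), organ GAP♯∘, node (RES-u) «from Thm 2's `u` to a residual re-gauging» (architect px17 g23 2026-09-01T01:09Z,
desk ★★OWNER g50 №704∕№708).  (RES-u) by name: sizes ✓p839678 `…S2BetaResidualCommutatorLetter` (w5 g28), doors ✓p839557∕✓p839644∕✓p839687 + the composed door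
`…S2BetaBodyDoorThm2Moved` (px16 g24: the moved pair's relative chord is `E·E′`, `E′ b = U₀ b·((ǔ⁻¹•U₀) b)⁻¹`, `ǔ⁻¹ = fun x => (liftTransfTo (u↓) x)⁻¹`), feed
`…S2BetaCovariantOscillationFeed` (px13 g29: consumes `‖E′ − 1‖ ≤ q`).  THIS FILE is the plumbing between them:

* §1 LATTICE: `blockUp k (x + e_μ) = blockUp k x ∨ blockUp k (x + e_μ) = blockUp k x + e_μ` — the `k`-fold iterate of lit ✓`B10StarCount.blockOf_shift`; the level
  identification commutes with steps (lit ✓`siteShift_shift`, here for the inverse map).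
* §2 ★`dist1_liftTransfTo_grad_le_of_bondGrad`: a gradient letter for the coarse `t` over coarse BONDS, `dist1 (t B₊·(t B₋)⁻¹) ≤ τ′` (`0 ≤ τ′`), gives ✓p839678 §4's
  image-pair hypothesis — the lift `ǔ = liftTransfTo t` has gradient `≤ τ′` across EVERY fine bond (interior bonds: `dist1 1 = 0`).
* §2′ ★`dist1_walkGrad_le_of_bondGrad` (generic telescoping along a lattice walk: per-bond `γ` ⟹ `|w|·γ`), `dist1_liftTransfTo_walkGrad_le_of_bondGrad` and (§4)
  `dist1_movedGauge_walkGrad_le` — the `hg : ∀ x w, dist1 (g x·(g (walkEnd x w))⁻¹) ≤ |w|·γ′` of px13 g29's (RES-u.6) «FRAME CHANGE» at `g := ǔ⁻¹`, `γ′ := τ′`.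
* §3 ★★`dist1_rel_liftRegauged_le_of_bondGrad` (+ `SU(n)` edition): ✓p839678's ★★ commutator letter with `hτ′` in coarse-bond form.
* §4 AT THE THM-2-MOVED BACKGROUND (px16's spelling, ANY fine `u`, `t := u↓ = descTransf u`): `ǔ⁻¹` IS the lift of `t⁻¹` (`rfl`), the gradient of `t⁻¹` has the `dist1` of the
  gradient of `t`; ★★`dist1_movedBkgRel_le_SU`: BKG bond class `σ` of `U₀` + coarse-bond gradient `τ′` of `u↓` ⟹ `dist1 (E′ b) ≤ 4σ + τ′` (generic `hcomm`: `≤ 2στ + τ′`;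
  interior bonds `≤ 4σ`).
* §5 ★★★`dist1_movedBkgRel_le_SU_of_defect` — EVERY INPUT NAMED: the defect equation `(u↓)⁻¹•V = D` ((RES-u.0): ✓p839687 `descendTo_rep_eq` gives `D = descendTo (E·U₀)`),
  the datum bond class `dist1 (V B) ≤ σ_V`, the coarse defect size `dist1 (D B·(V B)⁻¹) ≤ e` ⟹ `dist1 (E′ b) ≤ 4σ + (4σ_V + e)` on every fine bond (✓`dist1_coarseGrad_le_of_defect_SU`
  ∘ §4); so (RES-u.5)'s `q := 4σ + 4σ_V + e`, and the ONE input of the chain not on the tree is `e` — the size of the coarse defect `descendTo (E·U₀)·V⁻¹`, to be read from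
  [Balaban1985RegularSpaces] (1.37) `C137T` through the block-averaging dictionary (OPEN).
* §6 `SU(2)`, in (RES-u.5)'s currency (`dist1 = ‖· − 1‖`, lit ✓`T4ExpWindowSmallField.dist1_eq_norm_coe_sub_one`, `rfl`): ★★★`norm_movedBkgRel_sub_one_le_of_defect` —
  px13's `hX : ∀ b, ‖X b − 1‖ ≤ q` binder at `X b := ((E′ b : SU(2)) : M₂(ℂ))`, `q := 4σ + (4σ_V + e)` (and `_of_le` for any larger `q`).
`--kind proof --supports stmt-QuantumFields-20520 --as helper`, DEFINITION-FREE (0 `def`, 0 `instance`, 0 `sorry`; default heartbeats).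

HONEST.  Lattice bookkeeping and composition of landed letters; `hgrad` ∕ `hD` ∕ `hσV` ∕ `he` ∕ `hσ` are HYPOTHESES (sources: Thm 2's (1.36)–(1.37) read on the torus, the datum's
small-bond gauge, the (BKG) binder — NOT here); nothing of Bałaban's analysis is asserted or proved ([Balaban1985Averaging] (8) p.18, (11)–(13) p.19: gauge action, block-constant
lifts; [Balaban1987RG1] (0.3) p.252: blocks; [Balaban1985RegularSpaces] Thm 2 p.83, (1.36)–(1.38) p.82: the representative); (RES-u)'s dictionary input, (REG-UP), `hBG`, GAP♯∘
(`stub_uniformFibreGapOrbit`, 0∕5), the five REGISTERED stubs, S2β, crux 20520, 19936, 19200, `YM3TorusSU2` NOT proved; no summit statement is proved by a helper; rung R3 =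
SU(2) YM₃ on T³ — NOT d = 4, NOT infinite volume, NOT a mass gap, NOT Clay; the Yang–Mills mass gap is NOT proved.
-/

set_option autoImplicit false

noncomputable section

namespace Summit.QuantumFields.YangMills.Theorems.FluctuationComparisonRegPrIntLS2BetaLiftGradientFeed

open Literature.MathematicalPhysics.QuantumFieldTheory.Balaban1983to89
open T3ContinuumYM3Torus T3LevelShift T4Continuum
open T3UnitLawGaugeInvariance (blockUp)
open T3PrintedRegularOrbits (liftTransfTo descTransf sites_eq)
open B10StarCount (blockOf_shift)
open Summit.QuantumFields.YangMills.Theorems.FluctuationComparisonRegPrIntLS2BetaResidualCommutatorLetter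

/-! ## §1 Lattice: the image pair of a fine bond under `blockUp k` is a point or a coarse bond -/

section Lattice

variable {P : Params}

/-- ★ **THE IMAGE PAIR OF A FINE BOND IS A POINT OR A COARSE BOND**: `blockUp k (x + e_μ) = blockUp k x`, or `= blockUp k x + e_μ` (the `k`-fold iterate of
lit ✓`B10StarCount.blockOf_shift`: a carry in direction `μ` either stops at some level or propagates; standing range `k ≤ m + K`). [cite: Balaban1987RG1, (0.3) p.252] -/
theorem blockUp_shift_eq_or : ∀ (k : ℕ), k ≤ P.m + P.K → ∀ (x : Site P 0) (μ : Fin P.d),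
    blockUp k (x.shift μ) = blockUp k x ∨ blockUp k (x.shift μ) = (blockUp k x).shift μ
  | 0, _, _, _ => Or.inr rfl
  | k + 1, hk, x, μ => by
    have hk' : k ≤ P.m + P.K := by omega
    show blockOf (blockUp k (x.shift μ)) = blockOf (blockUp k x) ∨
      blockOf (blockUp k (x.shift μ)) = (blockOf (blockUp k x)).shift μ
    rcases blockUp_shift_eq_or k hk' x μ with h | h
    · exact Or.inl (congrArg blockOf h)
    · rw [h, blockOf_shift hk]
      split_ifs
      · exact Or.inr rfl
      · exact Or.inl rfl

end Lattice

/-- The INVERSE level identification commutes with the unit steps `y ↦ y + e_μ` (lit ✓`siteShift_shift` read backwards). [cite: Balaban1987RG1, (0.1) p.251] -/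
theorem siteShift_symm_shift {F : T3Family} {m K j m' K' j' : ℕ} (h : (F.PP m K).sitesPerDir j = (F.PP m' K').sitesPerDir j')
    (y : Site (F.PP m' K') j') (μ : Fin 3) :
    (siteShift h).symm (y.shift μ) = ((siteShift h).symm y).shift μ := by
  rw [Equiv.symm_apply_eq, siteShift_shift, Equiv.apply_symm_apply]

/-! ## §2 The gradient of the lift from a coarse-bond gradient letter -/

section Lift

variable (F : T3Family) {G : Type*} [GaugeGroup G] (n K : ℕ) (h : n ≤ K)

omit [GaugeGroup G] in
/-- The image pair `(π b₋, π b₊)` of a fine bond `b`, `π := siteShift⁻¹ ∘ blockUp (K − n)`: either ONE coarse site, or the coarse BOND `⟨π b₋, dir b⟩`.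
[cite: Balaban1987RG1, (0.3) p.252; Balaban1985Averaging, (12) p.19] -/
theorem imagePair_eq_or (b : PBond (F.P K) 0) :
    (siteShift (sites_eq F n K h)).symm (blockUp (K - n) b.tgt) = (siteShift (sites_eq F n K h)).symm (blockUp (K - n) b.src) ∨
      (siteShift (sites_eq F n K h)).symm (blockUp (K - n) b.tgt) =
        ((siteShift (sites_eq F n K h)).symm (blockUp (K - n) b.src)).shift b.dir := by
  have hk : K - n ≤ (F.P K).m + (F.P K).K := by show K - n ≤ F.m + K; omega
  rcases blockUp_shift_eq_or (K - n) hk b.src b.dir with hb | hb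
  · exact Or.inl (congrArg _ hb)
  · right
    calc (siteShift (sites_eq F n K h)).symm (blockUp (K - n) b.tgt)
        = (siteShift (sites_eq F n K h)).symm ((blockUp (K - n) b.src).shift b.dir) := congrArg _ hb
      _ = ((siteShift (sites_eq F n K h)).symm (blockUp (K - n) b.src)).shift b.dir :=
          siteShift_symm_shift (sites_eq F n K h) (blockUp (K - n) b.src) b.dir

/-- ★ **THE GRADIENT OF THE LIFT FROM A COARSE-BOND GRADIENT LETTER**: if `dist1 (t B₊·(t B₋)⁻¹) ≤ τ′` on every coarse BOND `B` (and `0 ≤ τ′`), then the lift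
`ǔ := liftTransfTo t` has `dist1 (ǔ b₊·(ǔ b₋)⁻¹) ≤ τ′` on every FINE bond `b` — ✓p839678 §4's image-pair hypothesis `hτ′`, supplied (interior bonds contribute `dist1 1 = 0`).
[cite: Balaban1985Averaging, (12) p.19; Balaban1987RG1, (0.3) p.252] -/
theorem dist1_liftTransfTo_grad_le_of_bondGrad {t : GaugeTransf (F.P n) 0 G} {τ' : ℝ} (hτ'0 : 0 ≤ τ')
    (hgrad : ∀ B : PBond (F.P n) 0, dist1 (t B.tgt * (t B.src)⁻¹) ≤ τ') (b : PBond (F.P K) 0) :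
    dist1 (liftTransfTo F n K h t b.tgt * (liftTransfTo F n K h t b.src)⁻¹) ≤ τ' := by
  rw [liftTransfTo_grad]
  rcases imagePair_eq_or F n K h b with hb | hb
  · rw [hb, mul_inv_cancel, GaugeGroup.dist1_one]
    exact hτ'0
  · rw [hb]
    exact hgrad ⟨(siteShift (sites_eq F n K h)).symm (blockUp (K - n) b.src), b.dir⟩

/-- The same in ✓p839678 §4's IMAGE-PAIR spelling. [cite: Balaban1985Averaging, (12) p.19] -/
theorem dist1_imagePair_grad_le_of_bondGrad {t : GaugeTransf (F.P n) 0 G} {τ' : ℝ} (hτ'0 : 0 ≤ τ')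
    (hgrad : ∀ B : PBond (F.P n) 0, dist1 (t B.tgt * (t B.src)⁻¹) ≤ τ') (b : PBond (F.P K) 0) :
    dist1 (t ((siteShift (sites_eq F n K h)).symm (blockUp (K - n) b.tgt)) *
        (t ((siteShift (sites_eq F n K h)).symm (blockUp (K - n) b.src)))⁻¹) ≤ τ' := by
  rw [← liftTransfTo_grad]
  exact dist1_liftTransfTo_grad_le_of_bondGrad F n K h hτ'0 hgrad b

end Lift

/-! ## §2′ Along lattice walks: accumulated gradients (the `hg` of (RES-u.6), px13 g29) -/

section Walk

variable {P : Params} {j : ℕ} {G : Type*} [GaugeGroup G]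

/-- The gradient of the pointwise inverse `g⁻¹` across a bond has the `dist1` of the gradient of `g`: `dist1 ((g b₊)⁻¹·((g b₋)⁻¹)⁻¹) = dist1 (g b₊·(g b₋)⁻¹)`
(inversion + conjugation invariance of `dist1`). [folklore] -/
theorem dist1_bondGrad_inv (g : Site P j → G) (b : PBond P j) :
    dist1 ((g b.tgt)⁻¹ * ((g b.src)⁻¹)⁻¹) = dist1 (g b.tgt * (g b.src)⁻¹) := by
  rw [← GaugeGroup.dist1_inv (g b.tgt * (g b.src)⁻¹), ← GaugeGroup.dist1_conj (g b.tgt * (g b.src)⁻¹)⁻¹ (g b.src)⁻¹,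
    mul_inv_rev, inv_inv, ← mul_assoc, inv_mul_cancel, one_mul]

/-- ★ **ACCUMULATED GRADIENT ALONG A WALK**: a per-bond gradient letter `dist1 (g b₊·(g b₋)⁻¹) ≤ γ` gives, along the walk spelled by any word `w` from `x`,
`dist1 (g x·(g (walkEnd x w))⁻¹) ≤ |w|·γ` (telescoping over the steps; backward steps by `dist1_inv`). [cite: Balaban1985Averaging, (8)-(9) p.18] -/
theorem dist1_walkGrad_le_of_bondGrad {g : Site P j → G} {γ : ℝ} (hgrad : ∀ b : PBond P j, dist1 (g b.tgt * (g b.src)⁻¹) ≤ γ) :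
    ∀ (x : Site P j) (w : List (Letter P.d)), dist1 (g x * (g (walkEnd x w))⁻¹) ≤ (w.length : ℝ) * γ
  | x, [] => by
    show dist1 (g x * (g x)⁻¹) ≤ ((0 : ℕ) : ℝ) * γ
    rw [mul_inv_cancel, GaugeGroup.dist1_one, Nat.cast_zero, zero_mul]
  | x, (μ, true) :: w => by
    have ih := dist1_walkGrad_le_of_bondGrad hgrad (x.shift μ) w
    have hstep : dist1 (g x * (g (x.shift μ))⁻¹) ≤ γ := by
      rw [← GaugeGroup.dist1_inv, mul_inv_rev, inv_inv]
      exact hgrad ⟨x, μ⟩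
    have hsplit : g x * (g (walkEnd x ((μ, true) :: w)))⁻¹ =
        (g x * (g (x.shift μ))⁻¹) * (g (x.shift μ) * (g (walkEnd (x.shift μ) w))⁻¹) := by
      show g x * (g (walkEnd (x.shift μ) w))⁻¹ = _
      rw [mul_assoc, inv_mul_cancel_left]
    rw [hsplit, List.length_cons, Nat.cast_succ, add_mul, one_mul, add_comm]
    exact (GaugeGroup.dist1_mul_le _ _).trans (add_le_add hstep ih)
  | x, (μ, false) :: w => by
    have ih := dist1_walkGrad_le_of_bondGrad hgrad (x.unshift μ) w
    have hstep : dist1 (g x * (g (x.unshift μ))⁻¹) ≤ γ := by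
      have h1 := hgrad ⟨x.unshift μ, μ⟩
      have htgt : PBond.tgt (⟨x.unshift μ, μ⟩ : PBond P j) = x := Site.shift_unshift x μ
      rwa [htgt] at h1
    have hsplit : g x * (g (walkEnd x ((μ, false) :: w)))⁻¹ =
        (g x * (g (x.unshift μ))⁻¹) * (g (x.unshift μ) * (g (walkEnd (x.unshift μ) w))⁻¹) := by
      show g x * (g (walkEnd (x.unshift μ) w))⁻¹ = _
      rw [mul_assoc, inv_mul_cancel_left]
    rw [hsplit, List.length_cons, Nat.cast_succ, add_mul, one_mul, add_comm]
    exact (GaugeGroup.dist1_mul_le _ _).trans (add_le_add hstep ih)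

end Walk

section LiftWalk

variable (F : T3Family) {G : Type*} [GaugeGroup G] (n K : ℕ) (h : n ≤ K)

/-- ★ THE LIFT ALONG A FINE WALK: a coarse-BOND gradient letter `τ′ ≥ 0` for `t` ⟹ `dist1 (ǔ x·(ǔ (walkEnd x w))⁻¹) ≤ |w|·τ′` for `ǔ = liftTransfTo t` and every fine word `w`
(§2 per step, §2′ telescoped) — the block-constant instance of (RES-u.6)'s `hg` with `γ′ := τ′`. [cite: Balaban1985Averaging, (8) p.18, (12) p.19] -/
theorem dist1_liftTransfTo_walkGrad_le_of_bondGrad {t : GaugeTransf (F.P n) 0 G} {τ' : ℝ} (hτ'0 : 0 ≤ τ')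
    (hgrad : ∀ B : PBond (F.P n) 0, dist1 (t B.tgt * (t B.src)⁻¹) ≤ τ') (x : Site (F.P K) 0) (w : List (Letter (F.P K).d)) :
    dist1 (liftTransfTo F n K h t x * (liftTransfTo F n K h t (walkEnd x w))⁻¹) ≤ (w.length : ℝ) * τ' :=
  dist1_walkGrad_le_of_bondGrad (fun b => dist1_liftTransfTo_grad_le_of_bondGrad F n K h hτ'0 hgrad b) x w

end LiftWalk

section Lift3

variable (F : T3Family) {G : Type*} [GaugeGroup G] (n K : ℕ) (h : n ≤ K)

/-! ## §3 The commutator letter at the lift, coarse-bond gradient form -/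

/-- ★★ **THE COMMUTATOR LETTER AT THE LIFT, COARSE-BOND FORM**: closeness `a`, background class `σ`, size `τ` and coarse-BOND gradient `τ′ ≥ 0` of the coarse `t` ⟹
`dist1 (X b·(((liftTransfTo t)•U₀) b)⁻¹) ≤ a + 2·σ·τ + τ′` on every fine bond (✓`dist1_rel_liftRegauged_le` ∘ §2). [cite: Balaban1985Averaging, (8) p.18, (12) p.19] -/
theorem dist1_rel_liftRegauged_le_of_bondGrad (hcomm : ∀ g g' : G, dist1 (g * g' * g⁻¹ * g'⁻¹) ≤ 2 * dist1 g * dist1 g')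
    {X U₀ : GaugeField (F.P K) 0 G} {t : GaugeTransf (F.P n) 0 G} {a σ τ τ' : ℝ}
    (hA : ∀ b : PBond (F.P K) 0, dist1 (X b * (U₀ b)⁻¹) ≤ a) (hσ : ∀ b : PBond (F.P K) 0, dist1 (U₀ b) ≤ σ)
    (hτ : ∀ y : Site (F.P n) 0, dist1 (t y) ≤ τ) (hτ'0 : 0 ≤ τ')
    (hgrad : ∀ B : PBond (F.P n) 0, dist1 (t B.tgt * (t B.src)⁻¹) ≤ τ') (b : PBond (F.P K) 0) :
    dist1 (X b * (GaugeField.gaugeAct (liftTransfTo F n K h t) U₀ b)⁻¹) ≤ a + 2 * σ * τ + τ' :=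
  dist1_rel_liftRegauged_le F n K h hcomm hA hσ hτ (fun b' => dist1_imagePair_grad_le_of_bondGrad F n K h hτ'0 hgrad b') b

end Lift3

section LiftSU

variable (F : T3Family) (n K : ℕ) (h : n ≤ K) {N : Type*} [Fintype N] [DecidableEq N] [Nonempty N]

/-- ★★ `SU(n)` EDITION: closeness `a`, background class `σ`, coarse-BOND gradient `τ′ ≥ 0` ⟹ `dist1 (X b·(((liftTransfTo t)•U₀) b)⁻¹) ≤ a + 4·σ + τ′`
(✓`dist1_rel_blockRegauged_le_SU` ∘ §2). [cite: Balaban1985Averaging, (8) p.18, (12) p.19] -/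
theorem dist1_rel_liftRegauged_le_SU_of_bondGrad {X U₀ : GaugeField (F.P K) 0 (Matrix.specialUnitaryGroup N ℂ)}
    {t : GaugeTransf (F.P n) 0 (Matrix.specialUnitaryGroup N ℂ)} {a σ τ' : ℝ}
    (hA : ∀ b : PBond (F.P K) 0, dist1 (X b * (U₀ b)⁻¹) ≤ a) (hσ : ∀ b : PBond (F.P K) 0, dist1 (U₀ b) ≤ σ) (hτ'0 : 0 ≤ τ')
    (hgrad : ∀ B : PBond (F.P n) 0, dist1 (t B.tgt * (t B.src)⁻¹) ≤ τ') (b : PBond (F.P K) 0) :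
    dist1 (X b * (GaugeField.gaugeAct (liftTransfTo F n K h t) U₀ b)⁻¹) ≤ a + 4 * σ + τ' :=
  dist1_rel_blockRegauged_le_SU (c := liftTransfTo F n K h t) hA hσ
    (fun b' => dist1_liftTransfTo_grad_le_of_bondGrad F n K h hτ'0 hgrad b') b

end LiftSU

/-! ## §4 At the Thm-2-moved background `ǔ⁻¹•U₀`, `ǔ⁻¹ = fun x => (liftTransfTo (u↓) x)⁻¹` (px16 g24's spelling; ANY fine `u`) -/

section Moved

variable (F : T3Family) {G : Type*} [GaugeGroup G] {J K : ℕ} (hJK : J ≤ K)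

omit [GaugeGroup G] in
/-- `ǔ⁻¹` IS THE LIFT OF `(u↓)⁻¹` (pointwise `rfl`; = `…BodyDoorThm2Moved.liftTransfTo_inv_fun` read backwards). [cite: Balaban1985Averaging, (12) p.19] -/
theorem liftDesc_inv_eq_lift_inv [Group G] (u : Site (F.P K) 0 → G) :
    (fun x => (liftTransfTo F J K hJK (descTransf F J K hJK u) x)⁻¹) =
      liftTransfTo F J K hJK (fun y => (descTransf F J K hJK u y)⁻¹) := by
  funext x; rfl

/-- Closeness `a = 0` of a field to itself: `dist1 (U₀ b·(U₀ b)⁻¹) ≤ 0`. [folklore] -/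
theorem dist1_rel_self_le (U₀ : GaugeField (F.P K) 0 G) : ∀ b : PBond (F.P K) 0, dist1 (U₀ b * (U₀ b)⁻¹) ≤ (0 : ℝ) := fun b => by
  rw [mul_inv_cancel, GaugeGroup.dist1_one]

/-- A coarse-bond gradient letter for `u↓` is one for `(u↓)⁻¹`. [folklore] -/
theorem bondGrad_inv_le {u : Site (F.P K) 0 → G} {τ' : ℝ}
    (hgrad : ∀ B : PBond (F.P J) 0, dist1 (descTransf F J K hJK u B.tgt * (descTransf F J K hJK u B.src)⁻¹) ≤ τ') :
    ∀ B : PBond (F.P J) 0, dist1 ((fun y => (descTransf F J K hJK u y)⁻¹) B.tgt * ((fun y => (descTransf F J K hJK u y)⁻¹) B.src)⁻¹) ≤ τ' :=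
  fun B => by rw [dist1_bondGrad_inv]; exact hgrad B

/-- ★★ **THE MOVED BACKGROUND'S COMMUTATOR FACTOR, generic edition**: background bond class `σ`, size `τ` of `(u↓)⁻¹`, coarse-BOND gradient `τ′ ≥ 0` of `u↓` ⟹
`dist1 (U₀ b·((ǔ⁻¹•U₀) b)⁻¹) ≤ 0 + 2·σ·τ + τ′` on every fine bond (px16's `E′`; ✓p839678 at `X := U₀`, `c := ǔ⁻¹`). [cite: Balaban1985Averaging, (8) p.18, (12) p.19] -/
theorem dist1_movedBkgRel_le (hcomm : ∀ g g' : G, dist1 (g * g' * g⁻¹ * g'⁻¹) ≤ 2 * dist1 g * dist1 g')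
    {u : Site (F.P K) 0 → G} {U₀ : GaugeField (F.P K) 0 G} {σ τ τ' : ℝ}
    (hσ : ∀ b : PBond (F.P K) 0, dist1 (U₀ b) ≤ σ) (hτ : ∀ y : Site (F.P J) 0, dist1 ((descTransf F J K hJK u y)⁻¹) ≤ τ) (hτ'0 : 0 ≤ τ')
    (hgrad : ∀ B : PBond (F.P J) 0, dist1 (descTransf F J K hJK u B.tgt * (descTransf F J K hJK u B.src)⁻¹) ≤ τ') (b : PBond (F.P K) 0) :
    dist1 (U₀ b * ((GaugeField.gaugeAct (fun x => (liftTransfTo F J K hJK (descTransf F J K hJK u) x)⁻¹) U₀) b)⁻¹) ≤ 0 + 2 * σ * τ + τ' := by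
  rw [liftDesc_inv_eq_lift_inv]
  exact dist1_rel_liftRegauged_le_of_bondGrad F J K hJK hcomm (t := fun y => (descTransf F J K hJK u y)⁻¹)
    (dist1_rel_self_le F U₀) hσ hτ hτ'0 (bondGrad_inv_le F hJK hgrad) b

/-- ★ (RES-u.6)'s `hg` AT THE MOVED GAUGE `g := ǔ⁻¹`: a coarse-BOND gradient letter `τ′ ≥ 0` for `u↓` ⟹ `dist1 (g x·(g (walkEnd x w))⁻¹) ≤ |w|·τ′` for every fine word
`w` (px13 g29 2026-09-01T01:55Z «FRAME CHANGE», `γ′ := τ′`). [cite: Balaban1985Averaging, (8) p.18, (12) p.19] -/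
theorem dist1_movedGauge_walkGrad_le {u : Site (F.P K) 0 → G} {τ' : ℝ} (hτ'0 : 0 ≤ τ')
    (hgrad : ∀ B : PBond (F.P J) 0, dist1 (descTransf F J K hJK u B.tgt * (descTransf F J K hJK u B.src)⁻¹) ≤ τ')
    (x : Site (F.P K) 0) (w : List (Letter (F.P K).d)) :
    dist1 ((fun x => (liftTransfTo F J K hJK (descTransf F J K hJK u) x)⁻¹) x *
        ((fun x => (liftTransfTo F J K hJK (descTransf F J K hJK u) x)⁻¹) (walkEnd x w))⁻¹) ≤ (w.length : ℝ) * τ' := by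
  rw [liftDesc_inv_eq_lift_inv]
  exact dist1_liftTransfTo_walkGrad_le_of_bondGrad F J K hJK (t := fun y => (descTransf F J K hJK u y)⁻¹)
    hτ'0 (bondGrad_inv_le F hJK hgrad) x w

end Moved

section MovedSU

variable (F : T3Family) {J K : ℕ} (hJK : J ≤ K) {N : Type*} [Fintype N] [DecidableEq N] [Nonempty N]

/-- ★★ **THE MOVED BACKGROUND'S COMMUTATOR FACTOR ON `SU(n)`**: background bond class `σ` and coarse-BOND gradient `τ′ ≥ 0` of `u↓` ⟹
`dist1 (U₀ b·((ǔ⁻¹•U₀) b)⁻¹) ≤ 4·σ + τ′` on every fine bond — (RES-u.5)'s `‖E′ − 1‖ ≤ q` with `q := 4σ + τ′` (`dist1 = ‖· − 1‖` on `SU(2)`, lit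
✓`T4ExpWindowSmallField.dist1_eq_norm_coe_sub_one`, `rfl`). [cite: Balaban1985Averaging, (8) p.18, (12) p.19] -/
theorem dist1_movedBkgRel_le_SU {u : Site (F.P K) 0 → Matrix.specialUnitaryGroup N ℂ}
    {U₀ : GaugeField (F.P K) 0 (Matrix.specialUnitaryGroup N ℂ)} {σ τ' : ℝ}
    (hσ : ∀ b : PBond (F.P K) 0, dist1 (U₀ b) ≤ σ) (hτ'0 : 0 ≤ τ')
    (hgrad : ∀ B : PBond (F.P J) 0, dist1 (descTransf F J K hJK u B.tgt * (descTransf F J K hJK u B.src)⁻¹) ≤ τ') (b : PBond (F.P K) 0) :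
    dist1 (U₀ b * ((GaugeField.gaugeAct (fun x => (liftTransfTo F J K hJK (descTransf F J K hJK u) x)⁻¹) U₀) b)⁻¹) ≤ 4 * σ + τ' := by
  rw [liftDesc_inv_eq_lift_inv]
  have h1 := dist1_rel_liftRegauged_le_SU_of_bondGrad F J K hJK (t := fun y => (descTransf F J K hJK u y)⁻¹)
    (dist1_rel_self_le F U₀) hσ hτ'0 (bondGrad_inv_le F hJK hgrad) b
  linarith

/-- INTERIOR BONDS: if both ends of the fine bond lie in ONE `(K − J)`-block, `dist1 (U₀ b·((ǔ⁻¹•U₀) b)⁻¹) ≤ 4·σ` (no gradient term).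
[cite: Balaban1985Averaging, (8) p.18, (12) p.19] -/
theorem dist1_movedBkgRel_le_SU_of_sameBlock {u : Site (F.P K) 0 → Matrix.specialUnitaryGroup N ℂ}
    {U₀ : GaugeField (F.P K) 0 (Matrix.specialUnitaryGroup N ℂ)} {σ : ℝ}
    (hσ : ∀ b : PBond (F.P K) 0, dist1 (U₀ b) ≤ σ) (b : PBond (F.P K) 0) (hb : blockUp (K - J) b.src = blockUp (K - J) b.tgt) :
    dist1 (U₀ b * ((GaugeField.gaugeAct (fun x => (liftTransfTo F J K hJK (descTransf F J K hJK u) x)⁻¹) U₀) b)⁻¹) ≤ 4 * σ := by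
  rw [liftDesc_inv_eq_lift_inv]
  have h1 := dist1_rel_blockRegauged_le_SU_of_eq (c := liftTransfTo F J K hJK (fun y => (descTransf F J K hJK u y)⁻¹))
    (dist1_rel_self_le F U₀) hσ b (liftTransfTo_src_eq_tgt_of_sameBlock F J K hJK _ b hb)
  linarith

/-! ## §5 From the defect equation: every input named -/

/-- THE DEFECT EQUATION IN ✓p839678 §3's BOND FORM: `(fun x => (t x)⁻¹)•V = D` ⟹ `(t B₋)⁻¹·V B·t B₊ = (D B·(V B)⁻¹)·V B` on every bond — so §3's `E` is the RELATIVE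
field `D·V⁻¹` of the defect (for (RES-u): `t = u↓`, `D = descendTo (E·U₀)` by ✓`…Thm2GaugeSplitResidual.descendTo_rep_eq`). [cite: Balaban1985RegularSpaces, (1.37) p.82; Balaban1985Averaging, (8) p.18] -/
theorem defect_bond_of_gaugeAct_inv_eq {P : Params} {j : ℕ} {G : Type*} [GaugeGroup G] {t : GaugeTransf P j G} {V D : GaugeField P j G}
    (hD : GaugeField.gaugeAct (fun x => (t x)⁻¹) V = D) :
    ∀ B : PBond P j, (t B.src)⁻¹ * V B * t B.tgt = (D B * (V B)⁻¹) * V B := by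
  intro B
  have hB := congrFun hD B
  rw [inv_mul_cancel_right, ← hB]
  show (t B.src)⁻¹ * V B * t B.tgt = (t B.src)⁻¹ * V B * ((t B.tgt)⁻¹)⁻¹
  rw [inv_inv]

/-- ★ THE COARSE-BOND GRADIENT OF `u↓` FROM THE DEFECT, `SU(n)`: `(u↓)⁻¹•V = D`, `dist1 (V B) ≤ σ_V`, `dist1 (D B·(V B)⁻¹) ≤ e` ⟹ `dist1 ((u↓) B₊·((u↓) B₋)⁻¹) ≤ 4σ_V + e`
(✓`dist1_coarseGrad_le_of_defect_SU`). [cite: Balaban1985RegularSpaces, Thm 2 p.83, (1.37) p.82] -/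
theorem bondGrad_descTransf_le_SU_of_defect {u : Site (F.P K) 0 → Matrix.specialUnitaryGroup N ℂ}
    {V D : GaugeField (F.P J) 0 (Matrix.specialUnitaryGroup N ℂ)} {σV e : ℝ}
    (hD : GaugeField.gaugeAct (fun x => (descTransf F J K hJK u x)⁻¹) V = D)
    (hσV : ∀ B : PBond (F.P J) 0, dist1 (V B) ≤ σV) (he : ∀ B : PBond (F.P J) 0, dist1 (D B * (V B)⁻¹) ≤ e) :
    ∀ B : PBond (F.P J) 0, dist1 (descTransf F J K hJK u B.tgt * (descTransf F J K hJK u B.src)⁻¹) ≤ 4 * σV + e :=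
  fun B => dist1_coarseGrad_le_of_defect_SU (E := fun B => D B * (V B)⁻¹) (defect_bond_of_gaugeAct_inv_eq hD) hσV he B

/-- ★★★ **THE MOVED BACKGROUND'S COMMUTATOR FACTOR WITH EVERY INPUT NAMED** (`SU(n)`): background bond class `σ` of `U₀` (the (BKG) binder), the defect equation
`(u↓)⁻¹•V = D` ((RES-u.0)), datum bond class `σ_V` (small-bond gauge of `V`), coarse defect size `dist1 (D B·(V B)⁻¹) ≤ e` ⟹ on every fine bond
`dist1 (U₀ b·((ǔ⁻¹•U₀) b)⁻¹) ≤ 4σ + (4σ_V + e)` — (RES-u.5)'s `q`.  The input `e` is [Balaban1985RegularSpaces] (1.37) read through the block-averaging dictionary (OPEN, not here).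
[cite: Balaban1985RegularSpaces, Thm 2 p.83, (1.36)-(1.38) p.82; Balaban1985Averaging, (8) p.18, (12) p.19] -/
theorem dist1_movedBkgRel_le_SU_of_defect {u : Site (F.P K) 0 → Matrix.specialUnitaryGroup N ℂ}
    {U₀ : GaugeField (F.P K) 0 (Matrix.specialUnitaryGroup N ℂ)} {V D : GaugeField (F.P J) 0 (Matrix.specialUnitaryGroup N ℂ)} {σ σV e : ℝ}
    (hσ : ∀ b : PBond (F.P K) 0, dist1 (U₀ b) ≤ σ)
    (hD : GaugeField.gaugeAct (fun x => (descTransf F J K hJK u x)⁻¹) V = D)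
    (hσV : ∀ B : PBond (F.P J) 0, dist1 (V B) ≤ σV) (he : ∀ B : PBond (F.P J) 0, dist1 (D B * (V B)⁻¹) ≤ e)
    (hσV0 : 0 ≤ σV) (he0 : 0 ≤ e) (b : PBond (F.P K) 0) :
    dist1 (U₀ b * ((GaugeField.gaugeAct (fun x => (liftTransfTo F J K hJK (descTransf F J K hJK u) x)⁻¹) U₀) b)⁻¹) ≤ 4 * σ + (4 * σV + e) :=
  dist1_movedBkgRel_le_SU F hJK hσ (by positivity) (bondGrad_descTransf_le_SU_of_defect F hJK hD hσV he) b

end MovedSU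

/-! ## §6 `SU(2)`, in (RES-u.5)'s currency: `‖X b − 1‖ ≤ q` for `X := E′` read as matrices (`dist1 = ‖· − 1‖`, `rfl`) -/

section FeedSU2

open scoped Matrix.Norms.L2Operator

variable (F : T3Family) {J K : ℕ} (hJK : J ≤ K)

/-- ★★★ **THE `q` OF (RES-u.5), INHABITED MODULO `e`**: with `X b := ((U₀ b·((ǔ⁻¹•U₀) b)⁻¹ : SU(2)) : M₂(ℂ))` (px16's `E′` of ✓`relChord_thm2Moved`, read as matrices — the `X` of
px13's ✓`wordOsc_mlog_mul`), the inputs of §5 give `‖X b − 1‖ ≤ 4σ + (4σ_V + e)` on every fine bond — the `hX : ∀ b, ‖X b − 1‖ ≤ q` binder of (RES-u.5) with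
`q := 4σ + (4σ_V + e)` (`dist1 U = ‖↑U − 1‖` on `SU(2)`, lit ✓`T4ExpWindowSmallField.dist1_eq_norm_coe_sub_one`, `rfl`). [cite: Balaban1985RegularSpaces, Thm 2 p.83, (1.36)-(1.38) p.82; Balaban1985Averaging, (8) p.18, (19) p.21] -/
theorem norm_movedBkgRel_sub_one_le_of_defect {u : Site (F.P K) 0 → Matrix.specialUnitaryGroup (Fin 2) ℂ}
    {U₀ : GaugeField (F.P K) 0 (Matrix.specialUnitaryGroup (Fin 2) ℂ)} {V D : GaugeField (F.P J) 0 (Matrix.specialUnitaryGroup (Fin 2) ℂ)} {σ σV e : ℝ}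
    (hσ : ∀ b : PBond (F.P K) 0, dist1 (U₀ b) ≤ σ)
    (hD : GaugeField.gaugeAct (fun x => (descTransf F J K hJK u x)⁻¹) V = D)
    (hσV : ∀ B : PBond (F.P J) 0, dist1 (V B) ≤ σV) (he : ∀ B : PBond (F.P J) 0, dist1 (D B * (V B)⁻¹) ≤ e)
    (hσV0 : 0 ≤ σV) (he0 : 0 ≤ e) :
    ∀ b : PBond (F.P K) 0,
      ‖((U₀ b * ((GaugeField.gaugeAct (fun x => (liftTransfTo F J K hJK (descTransf F J K hJK u) x)⁻¹) U₀) b)⁻¹ :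
          Matrix.specialUnitaryGroup (Fin 2) ℂ) : Matrix (Fin 2) (Fin 2) ℂ) - 1‖ ≤ 4 * σ + (4 * σV + e) := fun b => by
  rw [← T4ExpWindowSmallField.dist1_eq_norm_coe_sub_one]
  exact dist1_movedBkgRel_le_SU_of_defect F hJK hσ hD hσV he hσV0 he0 b

/-- The same with a free `q`: any `q ≥ 4σ + 4σ_V + e` is an admissible (RES-u.5) input. [cite: Balaban1985RegularSpaces, Thm 2 p.83; Balaban1985Averaging, (19) p.21] -/
theorem norm_movedBkgRel_sub_one_le_of_defect_of_le {u : Site (F.P K) 0 → Matrix.specialUnitaryGroup (Fin 2) ℂ}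
    {U₀ : GaugeField (F.P K) 0 (Matrix.specialUnitaryGroup (Fin 2) ℂ)} {V D : GaugeField (F.P J) 0 (Matrix.specialUnitaryGroup (Fin 2) ℂ)} {σ σV e q : ℝ}
    (hσ : ∀ b : PBond (F.P K) 0, dist1 (U₀ b) ≤ σ)
    (hD : GaugeField.gaugeAct (fun x => (descTransf F J K hJK u x)⁻¹) V = D)
    (hσV : ∀ B : PBond (F.P J) 0, dist1 (V B) ≤ σV) (he : ∀ B : PBond (F.P J) 0, dist1 (D B * (V B)⁻¹) ≤ e)
    (hσV0 : 0 ≤ σV) (he0 : 0 ≤ e) (hq : 4 * σ + 4 * σV + e ≤ q) :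
    ∀ b : PBond (F.P K) 0,
      ‖((U₀ b * ((GaugeField.gaugeAct (fun x => (liftTransfTo F J K hJK (descTransf F J K hJK u) x)⁻¹) U₀) b)⁻¹ :
          Matrix.specialUnitaryGroup (Fin 2) ℂ) : Matrix (Fin 2) (Fin 2) ℂ) - 1‖ ≤ q := fun b =>
  (norm_movedBkgRel_sub_one_le_of_defect F hJK hσ hD hσV he hσV0 he0 b).trans (by linarith)

end FeedSU2

end Summit.QuantumFields.YangMills.Theorems.FluctuationComparisonRegPrIntLS2BetaLiftGradientFeed

end
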